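import Literature.IUT.LogVolume.Xi1ArchModel
import Literature.IUT.LogThetaLattice.HolomorphicHull
import HarnessLib

/-!
# [IUTchIII] Remark 3.9.5 (iv) (Ξ2): the GLOBAL analogue of `Ξ(P)` is nonempty — PROVED in a model
# (archimedean radii vary continuously; nonarchimedean places abstract hull maps)

Mochizuki, [IUTchIII] Rmk. 3.9.5 (iv) (Ξ2), kurims p. 128 l.53–57 (read on the page): "(Ξ2) If one allows the
`v_ℚ ∈ 𝕍_ℚ` in the present discussion to vary, and one considers global situations [i.e., which necessarily
involve the unique valuation `∈ 𝕍_ℚ^{arc}`!] as in Proposition 3.9, (iii), then it is easily verified that the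
global analogue of '`Ξ(P)`' is nonempty."  Here, at one `v_ℚ`, `Ξ(P) := {H ∈ Hul | φ(P) ⊇ H, μ^{log}(H) =
μ^{log}(P)}` (Rmk. 3.9.5 (iii) p. 128); globally (Prop. 3.9 (iii) p. 117) a region is a family `(P_{v_ℚ})_{v_ℚ}`
and the global log-volume is the SUM of the local ones.  The layer-L6 file
`Literature/IUT/LogThetaLattice/HolomorphicHull.lean` (abc-iut-L6-t4) types (Ξ2) abstractly as
`LogThetaLattice.Xi2_globalNonempty`; campaign-S's `Xi1ArchModel.lean` proves (Ξ1^arc) (`arch_xiApprox_nonempty`: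
at the archimedean packet `⊕_j ℂ` one radius of `φ(P_∞)` can be shrunk CONTINUOUSLY to match any log-volume).

THIS proof-only file proves the global clause in the following model: finitely many nonarchimedean places `v ∈ V`,
each carrying an ABSTRACT hull system in the sense of L6's `IsHullMap (Preg_v) (Hul_v) (φ_v)` (Rmk. 3.9.5 (ii):
(P1)–(P3); instantiated e.g. by campaign-S's `isHullMap_holomorphicHull`) and a local log-volume `μ_v` with
`μ_v(P) ≤ μ_v(φ_v(P))` (monotonicity along (P2) `P ⊆ φ(P)`), together with the archimedean packet `⊕_{j∈J} ℂ`
(`J ≠ ∅`, campaign-S `ArchPacket`: direct product regions `Π_j A_j` with `A_j` compact of positive Lebesgue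
measure, hull-sets = polydiscs `⊕_j r_j·𝒪`, `φ_∞` = S2's `holomorphicHull`, `μ_∞ = nlogVol`):

* `ArchPacket.arch_hull_polydisc_nlogVol_shift` — for every `t ≤ 0` there is a polydisc INSIDE `φ_∞(P_∞)` of
  log-volume `nlogVol(P_∞) + t` (shrink one radius of the (Ξ1^arc) witness by `exp(|J|·t)`);
* `xi2_global_nonempty` — **(Ξ2)**: for every global region `((P_v)_v, P_∞)` there is a global hull `((H_v)_v, H_∞)`
  with `H_v ∈ Hul_v`, `H_v ⊆ φ_v(P_v)`, `H_∞` a polydisc `⊆ φ_∞(P_∞)`, and TOTAL log-volume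
  `Σ_v μ_v(H_v) + nlogVol(H_∞) = Σ_v μ_v(P_v) + nlogVol(P_∞)`: take `H_v := φ_v(P_v)` (excess `E ≥ 0`) and absorb
  `−E` at the archimedean place.
[cite: Mochizuki2012, IUTchIII Rmk. 3.9.5 (iv) p. 128] [cite: Mochizuki2012, IUTchIII Prop. 3.9 (iii) p. 117]
HONEST SCOPE: the nonarchimedean side is abstract (any hull maps, any monotone local log-volumes, any weights);
the archimedean side is S2's equal-weight `nlogVol` on `⊕_j ℂ`.  Nothing here bears on [IUTchIII] Cor. 3.12
(Rmk. 3.9.5 (iv) lies outside its cone) or takes a side.  No definitions.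
-/

noncomputable section

open MeasureTheory Set Metric Bornology
open scoped ENNReal Pointwise

namespace Literature.IUT.LogVolume

namespace ArchPacket

variable (J : Type) [Fintype J] [Nonempty J]

/-- **Archimedean volume shift.**  For a direct product region `P = Π_j A_j ⊆ ⊕_j ℂ` and every `t ≤ 0` there is a
hull-set `⊕_j r_j·𝒪` (`r_j > 0`) inside `φ(P)` with `nlogVol = nlogVol(P) + t` — PROVED from (Ξ1^arc)
(`arch_xiApprox_nonempty`) by shrinking one radius by `exp(|J|·t) ≤ 1` (archimedean radii vary continuously).
[cite: Mochizuki2012, IUTchIII Rmk. 3.9.5 (iv) p. 128] -/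
theorem arch_hull_polydisc_nlogVol_shift {A : J → Set ℂ} (hAc : ∀ j, IsCompact (A j))
    (hApos : ∀ j, 0 < volume (A j)) {t : ℝ} (ht : t ≤ 0) :
    ∃ r : J → ℝ, (∀ j, 0 < r j) ∧
      ArchPacket.polydisc J r ⊆ LogVolume.holomorphicHull (fun _ : J => ℂ) (Set.pi univ A) ∧
      nlogVol J (ArchPacket.polydisc J r) = nlogVol J (Set.pi univ A) + t := by
  classical
  obtain ⟨R, hRpos, hRsub, hRvol⟩ := arch_xiApprox_nonempty J hAc hApos
  obtain ⟨j₀⟩ := (inferInstance : Nonempty J)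
  set r : J → ℝ := Function.update R j₀ (R j₀ * Real.exp (Fintype.card J * t)) with hrdef
  have hrpos : ∀ j, 0 < r j := fun j => by
    by_cases hj : j = j₀
    · subst hj; simp [hrdef, hRpos, Real.exp_pos]
    · rw [hrdef, Function.update_of_ne hj]; exact hRpos j
  have hrle : ∀ j, r j ≤ R j := fun j => by
    by_cases hj : j = j₀
    · subst hj
      simp only [hrdef, Function.update_self]
      have : Real.exp (Fintype.card J * t) ≤ 1 :=
        Real.exp_le_one_iff.mpr (mul_nonpos_of_nonneg_of_nonpos (Nat.cast_nonneg _) ht)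
      exact mul_le_of_le_one_right (hRpos j).le this
    · rw [hrdef, Function.update_of_ne hj]
  refine ⟨r, hrpos, ?_, ?_⟩
  · refine Set.Subset.trans ?_ hRsub
    rw [polydisc_eq, polydisc_eq]
    exact LogVolume.polydisc_mono (fun _ : J => ℂ) hrle
  · rw [nlogVol_polydisc J hrpos, ← hRvol, nlogVol_polydisc J hRpos]
    have hJ : (Fintype.card J : ℝ) ≠ 0 := by exact_mod_cast Fintype.card_ne_zero
    have hsum : ∑ j, Real.log (r j) = ∑ j, Real.log (R j) + Fintype.card J * t := by
      have h1 : ∑ j, Real.log (r j) =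
          Real.log (r j₀) + ∑ j ∈ Finset.univ.erase j₀, Real.log (r j) :=
        (Finset.add_sum_erase _ _ (Finset.mem_univ j₀)).symm
      have h2 : ∑ j, Real.log (R j) =
          Real.log (R j₀) + ∑ j ∈ Finset.univ.erase j₀, Real.log (R j) :=
        (Finset.add_sum_erase _ _ (Finset.mem_univ j₀)).symm
      have h3 : ∑ j ∈ Finset.univ.erase j₀, Real.log (r j) =
          ∑ j ∈ Finset.univ.erase j₀, Real.log (R j) :=
        Finset.sum_congr rfl fun j hj => by
          rw [hrdef, Function.update_of_ne (Finset.ne_of_mem_erase hj)]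
      have h4 : Real.log (r j₀) = Real.log (R j₀) + Fintype.card J * t := by
        simp only [hrdef, Function.update_self]
        rw [Real.log_mul (hRpos j₀).ne' (Real.exp_pos _).ne', Real.log_exp]
      rw [h1, h2, h3, h4]
      ring
    rw [hsum, mul_add]
    field_simp

end ArchPacket

/-- **IUTchIII:Rmk3.9.5(iv) (Ξ2), explicit form.**  In the model of the module docstring, for every global
region `((P_v)_v, P_∞ = Π_j A_j)` there is an archimedean hull-set `⊕_j r_j·𝒪 ⊆ φ_∞(P_∞)` such that the global
hull `((φ_v(P_v))_v, ⊕_j r_j·𝒪)` has the SAME total log-volume as the region: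
`Σ_v μ_v(φ_v(P_v)) + nlogVol(⊕ r_j·𝒪) = Σ_v μ_v(P_v) + nlogVol(P_∞)` — the nonarchimedean excess
`E = Σ_v (μ_v(φ_v P_v) − μ_v(P_v)) ≥ 0` is absorbed at the archimedean place (only the TOTAL is matched, which
is why (Ξ2) holds globally while (Ξ1^non) can fail locally, cell register E-13) — PROVED.
[cite: Mochizuki2012, IUTchIII Rmk. 3.9.5 (iv) p. 128] -/
theorem xi2_global_nonempty_explicit {V : Type*} [Fintype V] {X : V → Type*}
    (Preg : ∀ v, Set (Set (X v))) (φ : ∀ v, Set (X v) → Set (X v)) (μ : ∀ v, Set (X v) → ℝ)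
    (hmono : ∀ v (P : Set (X v)), P ∈ Preg v → μ v P ≤ μ v (φ v P))
    (J : Type) [Fintype J] [Nonempty J]
    (P : ∀ v, Set (X v)) (hP : ∀ v, P v ∈ Preg v)
    {A : J → Set ℂ} (hAc : ∀ j, IsCompact (A j)) (hApos : ∀ j, 0 < volume (A j)) :
    ∃ r : J → ℝ, (∀ j, 0 < r j) ∧
      ArchPacket.polydisc J r ⊆ LogVolume.holomorphicHull (fun _ : J => ℂ) (Set.pi univ A) ∧
      (∑ v, μ v (φ v (P v))) + ArchPacket.nlogVol J (ArchPacket.polydisc J r) =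
        (∑ v, μ v (P v)) + ArchPacket.nlogVol J (Set.pi univ A) := by
  -- the nonarchimedean excess `E = Σ_v (μ_v(φ_v P_v) − μ_v(P_v)) ≥ 0`
  set E : ℝ := ∑ v, (μ v (φ v (P v)) - μ v (P v)) with hE
  have hE0 : 0 ≤ E := Finset.sum_nonneg fun v _ => sub_nonneg.mpr (hmono v (P v) (hP v))
  obtain ⟨r, hrpos, hrsub, hrvol⟩ :=
    ArchPacket.arch_hull_polydisc_nlogVol_shift J hAc hApos (t := -E) (by linarith)
  refine ⟨r, hrpos, hrsub, ?_⟩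
  rw [hrvol]
  have hsum : ∑ v, μ v (φ v (P v)) = ∑ v, μ v (P v) + E := by
    rw [hE, ← Finset.sum_add_distrib]
    exact Finset.sum_congr rfl fun v _ => by ring
  rw [hsum]
  ring

/-- **IUTchIII:Rmk3.9.5(iv) (Ξ2) — the global analogue of `Ξ(P)` is nonempty**, PROVED in the model described in
the module docstring: nonarchimedean places `v ∈ V` (finite) with abstract hull maps `φ_v : Preg_v → Hul_v`
((P1)–(P3), L6's `IsHullMap`) and local log-volumes `μ_v` with `μ_v(P) ≤ μ_v(φ_v(P))`, plus the archimedean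
packet `⊕_{j∈J} ℂ` with S2's hull and `nlogVol`.  For every global region there is a global hull — members of
`Hul_v` INSIDE `φ_v(P_v)` at every finite place and a polydisc inside `φ_∞(P_∞)` — with the SAME total
log-volume. [cite: Mochizuki2012, IUTchIII Rmk. 3.9.5 (iv) p. 128] -/
theorem xi2_global_nonempty {V : Type*} [Fintype V] {X : V → Type*}
    (Preg Hul : ∀ v, Set (Set (X v))) (φ : ∀ v, Set (X v) → Set (X v)) (μ : ∀ v, Set (X v) → ℝ)
    (hφ : ∀ v, LogThetaLattice.IsHullMap (Preg v) (Hul v) (φ v))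
    (hmono : ∀ v (P : Set (X v)), P ∈ Preg v → μ v P ≤ μ v (φ v P))
    (J : Type) [Fintype J] [Nonempty J]
    (P : ∀ v, Set (X v)) (hP : ∀ v, P v ∈ Preg v)
    {A : J → Set ℂ} (hAc : ∀ j, IsCompact (A j)) (hApos : ∀ j, 0 < volume (A j)) :
    ∃ (H : ∀ v, Set (X v)) (r : J → ℝ),
      (∀ v, H v ∈ Hul v ∧ H v ⊆ φ v (P v)) ∧ (∀ j, 0 < r j) ∧
      ArchPacket.polydisc J r ⊆ LogVolume.holomorphicHull (fun _ : J => ℂ) (Set.pi univ A) ∧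
      (∑ v, μ v (H v)) + ArchPacket.nlogVol J (ArchPacket.polydisc J r) =
        (∑ v, μ v (P v)) + ArchPacket.nlogVol J (Set.pi univ A) := by
  obtain ⟨r, hrpos, hrsub, hrvol⟩ := xi2_global_nonempty_explicit Preg φ μ hmono J P hP hAc hApos
  exact ⟨fun v => φ v (P v), r, fun v => ⟨(hφ v).maps (P v) (hP v), subset_rfl⟩, hrpos, hrsub, hrvol⟩

end Literature.IUT.LogVolume
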